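import Literature.NumberTheory.GaloisRepresentations.CompletionCompositumEmbedding
import Literature.NumberTheory.GaloisRepresentations.SemiLocalHomAssembly
import Literature.NumberTheory.GaloisRepresentations.KummerSES
import HarnessLib

/-!
# Local equivariant homomorphisms `X → K̄_vˣ` versus `G_{w_v}`-morphisms `X → E_{w_v}ˣ` and `G`-morphisms
# `X → ∏_{w∣v} E_wˣ`: the finite-place factor of `Hom_G(N₁, J_E) = ∏'_v Hom_{Γ_{K_v}}(N₁, K̄_vˣ)`
# (Milne *ADT* I Lemma 4.13; Cassels–Fröhlich VII §1.1; Harari §13.1)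

Topic `NumberTheory/GaloisRepresentations`; namespace `Literature.NumberTheory.GaloisRepresentations.IdeleReadout`
(a new namespace for the readout/assembly dictionary of the presentation road; `SemiLocal` and `DiscreteGaloisModule`
are opened).  Definitions with bodies and theorems; NO named fact, no `sorry`, no instance, no notation; number fields
in `Type`.  Sequel to door-c5 g17's `CompletionCompositumEmbedding.lean` (`embPlace v ιE = w_v`, `compositumEquivEmb = θ`,
`placeEmb : E_{w_v} →ₐ[K_v] K̄_v`, its equivariance and unit transport) and `SemiLocalHomAssembly.lean`
(`assemble w φ : X ⟶ ∏_{w∣v} E_wˣ` from a `G_w`-morphism `φ : Res X ⟶ E_wˣ`).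

Why (Route A of crux `AnticycControlAdditiveK`, item 19295; door-c6 g16's presentation road, hypotheses (R-def)
and (R3) of `middleExact_allPlaces_of_readout`, FINDING-door-c6-g16 §5).  The local halves of the road produce, at
a finite place `v` of `K`, a homomorphism `h : X → K̄_vˣ` (`UnitsCarrier K_v`) equivariant for `Γ_{K_v}` acting
on `X` through `Γ_{K_v} → Γ_K → Gal(E/K)` (door-c6 `HomDual.dualδ₀_units_restrict_surjective`,
`exists_algNorm_eq_one_of_unramified`); the idèle-valued map needs, at every place `w ∣ v` of the layer `E`, a
component in `E_wˣ`.  This file is the dictionary between the two: `Γ_{K_v}` restricts onto the decomposition group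
`G_{w_v}` of the distinguished place (`galRestrict`, `galRestrict_smul_embPlace`, `galRestrictStab_surjective`),
an equivariant `h` takes values in `K_v(E) = placeEmb(E_{w_v})` (its values are fixed by the kernel), so
`θ ∘ h : X → E_{w_v}ˣ` is a `G_{w_v}`-morphism (`localHomLift`), which `assemble` extends to `X → ∏_{w∣v} E_wˣ`
(`assembleLocalHom`); conversely the `w_v`-component of a `G`-morphism followed by `placeEmb` is a
`Γ_{K_v}`-equivariant `X → K̄_vˣ` (`localReadout`), and the two constructions are inverse
(`localReadout_assembleLocalHom`, `assembleLocalHom_localReadout`).  Units: `‖h x‖ = 1` for all `x` iff the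
assembled map takes values in `∏_{w∣v} 𝒪_wˣ` at the distinguished component (`mem_placeUnitGroup_localHomLift_iff`),
whence `assembleLocalHomUnit : X ⟶ unitGroupRep K E v`.

## What is formalised (`K E : Type` number fields, `[IsGalois K E]`, `ιE : E →ₐ[K] K̄`, `v` finite, `G = E ≃ₐ[K] E`,
## `X : Rep ℤ G`)

* §1 **`galRestrict v ιE : Γ_{K_v} →* Gal(E/K)`** (`ιE (galRestrict d e) = res d • ιE e`), `galRestrict_smul_embPlace`,
  **`galRestrictStab v ιE : Γ_{K_v} →* G_{w_v}`**, **`galRestrictStab_surjective`**, `galRestrict_eq_one_iff`-type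
  lemma `smul_placeEmb_of_galRestrict_eq_one`.
* §2 `IsLocalHom v ιE X h` (the equivariance predicate `h (g_d • x) = d • h x`), `exists_placeEmb_eq_of_isLocalHom`,
  **`localHomLift`** (`Res_{G_{w_v}} X ⟶ localUnitsRep w_v`) with **`placeEmb_localHomLift`**
  (`placeEmb (θ h x) = h x`), **`mem_placeUnitGroup_localHomLift_iff`** (`θ h x ∈ 𝒪ˣ ↔ ‖h x‖ = 1`),
  **`assembleLocalHom`** (`X ⟶ unitsRep K E v`), `assembleLocalHomUnit` (`X ⟶ unitGroupRep K E v`).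
* §3 **`localReadout Φ : X.V →+ UnitsCarrier K_v`** (`= placeEmb ∘ pr_{w_v} ∘ Φ`), **`isLocalHom_localReadout`**,
  **`localReadout_assembleLocalHom`** (`= h`), **`assembleLocalHom_localReadout`** (`= Φ`).

## References
* J. S. Milne, *Arithmetic Duality Theorems* (2nd ed. 2006), I Lemma 4.13 (proof). [MilneADT2006]
* J. W. S. Cassels, A. Fröhlich (eds.), *Algebraic Number Theory* (1967), Ch. VII (Tate) §1.1, Prop. 1.2. [CasselsFrohlichANT1967]
* D. Harari, *Galois Cohomology and Class Field Theory* (2020), §13.1. [Harari2020]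
-/

noncomputable section

open NumberField IsDedekindDomain Field CategoryTheory
open Literature.NumberTheory.Automorphic

namespace Literature.NumberTheory.GaloisRepresentations

namespace IdeleReadout

open SemiLocal DiscreteGaloisModule Literature.Algebra.Homology

variable {K : Type} [Field K] [NumberField K] {E : Type} [Field E] [NumberField E] [Algebra K E]
variable (v : HeightOneSpectrum (𝓞 K)) [IsGalois K E] (ιE : E →ₐ[K] AlgebraicClosure K)

/-! ## §1. `Γ_{K_v} → Gal(E/K)` lands onto the decomposition group of the distinguished place -/

omit [NumberField E] in
/-- **The restriction `Γ_{K_v} → Gal(E/K)`, `d ↦ (d|_{K̄})|_E`** along the chosen `K̄ → K̄_v` and `ιE : E → K̄`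
(`E/K` normal). [cite: CasselsFrohlichANT1967, Ch. VII §1.1] -/
def galRestrict : absoluteGaloisGroup (v.adicCompletion K) →* (E ≃ₐ[K] E) :=
  letI : Algebra E (AlgebraicClosure K) := ιE.toRingHom.toAlgebra
  haveI : IsScalarTower K E (AlgebraicClosure K) := IsScalarTower.of_algebraMap_eq fun x => (ιE.commutes x).symm
  (AlgEquiv.restrictNormalHom (F := K) (K₁ := AlgebraicClosure K) E).comp
    (absGaloisRestrict K (v.adicCompletion K)).toMonoidHom

omit [NumberField E] in
/-- **`ιE (galRestrict d e) = d|_{K̄} • ιE e`** (the defining property of the restriction).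
[cite: CasselsFrohlichANT1967, Ch. VII §1.1] -/
theorem ιE_galRestrict (d : absoluteGaloisGroup (v.adicCompletion K)) (e : E) :
    ιE (galRestrict v ιE d e) = absGaloisRestrict K (v.adicCompletion K) d • ιE e := by
  letI : Algebra E (AlgebraicClosure K) := ιE.toRingHom.toAlgebra
  haveI : IsScalarTower K E (AlgebraicClosure K) := IsScalarTower.of_algebraMap_eq fun x => (ιE.commutes x).symm
  exact AlgEquiv.restrictNormal_commutes (absGaloisRestrict K (v.adicCompletion K) d) E e

omit [NumberField E] in
/-- Any `g` with the restriction property IS `galRestrict d` (`restrict_unique`). [cite: CasselsFrohlichANT1967, Ch. VII §1.1] -/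
theorem eq_galRestrict {d : absoluteGaloisGroup (v.adicCompletion K)} {g : E ≃ₐ[K] E}
    (hg : ∀ e : E, ιE (g e) = absGaloisRestrict K (v.adicCompletion K) d • ιE e) : g = galRestrict v ιE d :=
  restrict_unique v ιE hg (ιE_galRestrict v ιE d)

/-- **`galRestrict d` fixes the distinguished place `w_v`.** [cite: CasselsFrohlichANT1967, Ch. VII §1.1] -/
theorem galRestrict_smul_embPlace (d : absoluteGaloisGroup (v.adicCompletion K)) :
    galRestrict v ιE d • embPlace v ιE = embPlace v ιE :=
  smul_embPlace_eq v ιE (ιE_galRestrict v ιE d)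

/-- **`Γ_{K_v} → G_{w_v}`**, the restriction with values in the decomposition group of the distinguished place.
[cite: CasselsFrohlichANT1967, Ch. VII §1.1] -/
def galRestrictStab : absoluteGaloisGroup (v.adicCompletion K) →* MulAction.stabilizer (E ≃ₐ[K] E) (embPlace v ιE) :=
  (galRestrict v ιE).codRestrict _ fun d => MulAction.mem_stabilizer_iff.mpr (galRestrict_smul_embPlace v ιE d)

/-- `(galRestrictStab d : G) = galRestrict d`. [cite: CasselsFrohlichANT1967, Ch. VII §1.1] -/
@[simp] theorem coe_galRestrictStab (d : absoluteGaloisGroup (v.adicCompletion K)) :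
    (galRestrictStab v ιE d : E ≃ₐ[K] E) = galRestrict v ιE d := rfl

/-- **`Γ_{K_v} → G_{w_v}` is onto** (`exists_restrict_of_smul_embPlace_eq`).
[cite: CasselsFrohlichANT1967, Ch. VII §1.1, Prop. 1.2] -/
theorem galRestrictStab_surjective : Function.Surjective (galRestrictStab v ιE) := fun g => by
  obtain ⟨d, hd⟩ := exists_restrict_of_smul_embPlace_eq v ιE (MulAction.mem_stabilizer_iff.mp g.2)
  exact ⟨d, Subtype.ext (eq_galRestrict v ιE hd).symm⟩

/-- The kernel of `galRestrict` fixes the image of `placeEmb` pointwise. [cite: CasselsFrohlichANT1967, Ch. VII §1.1] -/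
theorem smul_placeEmb_of_galRestrict_eq_one {d : absoluteGaloisGroup (v.adicCompletion K)}
    (hd : galRestrict v ιE d = 1) (y : (embPlace v ιE : HeightOneSpectrum (𝓞 E)).adicCompletion E) :
    d • placeEmb v ιE y = placeEmb v ιE y :=
  smul_placeEmb_of_restrict_eq_one v ιE (fun e => by rw [← ιE_galRestrict v ιE d e, hd, AlgEquiv.one_apply]) y

/-! ## §2. From a `Γ_{K_v}`-equivariant `h : X → K̄_vˣ` to a `G`-morphism `X → ∏_{w∣v} E_wˣ` -/

variable {X : Rep.{0} ℤ (E ≃ₐ[K] E)}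

/-- **Local equivariance**: `h : X → K̄_vˣ` satisfies `h(d|_E • x) = d • h(x)` for `d ∈ Γ_{K_v}` (`Γ_{K_v}` acting on
`X` through `galRestrict` and on `K̄_vˣ` = `units K_v` naturally) — the invariants of `Hom(X, K̄_vˣ)` in door-c6's
currency. [cite: MilneADT2006, I Lemma 4.13 (proof)] -/
def IsLocalHom (X : Rep.{0} ℤ (E ≃ₐ[K] E)) (h : X.V →+ UnitsCarrier (v.adicCompletion K)) : Prop :=
  ∀ (d : absoluteGaloisGroup (v.adicCompletion K)) (x : X.V),
    h (X.ρ (galRestrict v ιE d) x) = units (v.adicCompletion K) d (h x)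

variable {v ιE}

/-- **The values of a local equivariant `h` lie in `K_v(E) = placeEmb(E_{w_v})`** (they are fixed by the kernel of
`galRestrict`). [cite: CasselsFrohlichANT1967, Ch. VII §1.1] -/
theorem exists_placeEmb_eq_of_isLocalHom {h : X.V →+ UnitsCarrier (v.adicCompletion K)} (hh : IsLocalHom v ιE X h)
    (x : X.V) :
    ∃ y, placeEmb v ιE y = (unitsVal (v.adicCompletion K) (h x) : AlgebraicClosure (v.adicCompletion K)) := by
  letI : Module ℤ X.V := X.hV2
  refine exists_placeEmb_eq_of_forall_smul v ιE fun d hd => ?_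
  have hg : galRestrict v ιE d = 1 := by
    refine (eq_galRestrict v ιE (g := 1) fun e => ?_).symm
    rw [AlgEquiv.one_apply, hd]
  have h1 := hh d x
  rw [hg, map_one, Module.End.one_apply] at h1
  rw [← Units.coe_smul, ← unitsVal_apply, ← h1]

/-- The value `θ(h x) ∈ E_{w_v}` (auxiliary). [cite: CasselsFrohlichANT1967, Ch. II §10] -/
def localHomVal {h : X.V →+ UnitsCarrier (v.adicCompletion K)} (hh : IsLocalHom v ιE X h) (x : X.V) :
    (embPlace v ιE : HeightOneSpectrum (𝓞 E)).adicCompletion E :=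
  Classical.choose (exists_placeEmb_eq_of_isLocalHom hh x)

/-- `placeEmb (θ(h x)) = h x`. [cite: CasselsFrohlichANT1967, Ch. II §10] -/
theorem placeEmb_localHomVal {h : X.V →+ UnitsCarrier (v.adicCompletion K)} (hh : IsLocalHom v ιE X h) (x : X.V) :
    placeEmb v ιE (localHomVal hh x) = (unitsVal (v.adicCompletion K) (h x) : AlgebraicClosure (v.adicCompletion K)) :=
  Classical.choose_spec (exists_placeEmb_eq_of_isLocalHom hh x)

/-- `θ(h x) ≠ 0`. [cite: CasselsFrohlichANT1967, Ch. II §10] -/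
theorem localHomVal_ne_zero {h : X.V →+ UnitsCarrier (v.adicCompletion K)} (hh : IsLocalHom v ιE X h) (x : X.V) :
    localHomVal hh x ≠ 0 := fun h0 => by
  have h1 := placeEmb_localHomVal hh x
  rw [h0, map_zero] at h1
  exact (unitsVal (v.adicCompletion K) (h x)).ne_zero h1.symm

/-- `θ(h x)` as a unit of `E_{w_v}`. [cite: CasselsFrohlichANT1967, Ch. II §10] -/
def localHomUnit {h : X.V →+ UnitsCarrier (v.adicCompletion K)} (hh : IsLocalHom v ιE X h) (x : X.V) :
    ((embPlace v ιE : HeightOneSpectrum (𝓞 E)).adicCompletion E)ˣ :=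
  Units.mk0 (localHomVal hh x) (localHomVal_ne_zero hh x)

/-- `placeEmb` of the unit `θ(h x)` is `h x`, as units of `K̄_v`. [cite: CasselsFrohlichANT1967, Ch. II §10] -/
theorem map_placeEmb_localHomUnit {h : X.V →+ UnitsCarrier (v.adicCompletion K)} (hh : IsLocalHom v ιE X h)
    (x : X.V) :
    Units.map (placeEmb v ιE).toRingHom.toMonoidHom (localHomUnit hh x) =
      unitsVal (v.adicCompletion K) (h x) :=
  Units.ext (placeEmb_localHomVal hh x)

/-- `θ(h x)` is characterised by `placeEmb (θ(h x)) = h x`. [cite: CasselsFrohlichANT1967, Ch. II §10] -/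
theorem localHomUnit_eq_iff {h : X.V →+ UnitsCarrier (v.adicCompletion K)} (hh : IsLocalHom v ιE X h) (x : X.V)
    (u : ((embPlace v ιE : HeightOneSpectrum (𝓞 E)).adicCompletion E)ˣ) :
    localHomUnit hh x = u ↔ placeEmb v ιE (u : (embPlace v ιE : HeightOneSpectrum (𝓞 E)).adicCompletion E) =
      (unitsVal (v.adicCompletion K) (h x) : AlgebraicClosure (v.adicCompletion K)) := by
  constructor
  · rintro rfl
    exact placeEmb_localHomVal hh x
  · intro hu
    exact Units.ext (placeEmb_injective v ιE ((placeEmb_localHomVal hh x).trans hu.symm))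

/-- `θ(h (x + y)) = θ(h x) θ(h y)`. [cite: CasselsFrohlichANT1967, Ch. II §10] -/
theorem localHomUnit_add {h : X.V →+ UnitsCarrier (v.adicCompletion K)} (hh : IsLocalHom v ιE X h) (x y : X.V) :
    localHomUnit hh (x + y) = localHomUnit hh x * localHomUnit hh y := by
  rw [localHomUnit_eq_iff, Units.val_mul, map_mul, map_add, unitsVal_add, Units.val_mul]
  change placeEmb v ιE (localHomVal hh x) * placeEmb v ιE (localHomVal hh y) = _
  rw [placeEmb_localHomVal, placeEmb_localHomVal]

/-- `θ(h 0) = 1`. [cite: CasselsFrohlichANT1967, Ch. II §10] -/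
theorem localHomUnit_zero {h : X.V →+ UnitsCarrier (v.adicCompletion K)} (hh : IsLocalHom v ιE X h) :
    localHomUnit hh 0 = 1 := by
  rw [localHomUnit_eq_iff, Units.val_one, map_one, map_zero]
  rfl

/-- **Equivariance of `θ ∘ h` under the decomposition group**: `θ(h(g x)) = g_{w_v}(θ(h x))` for `g ∈ G_{w_v}`
(choose `d ∈ Γ_{K_v}` restricting to `g`, `galRestrictStab_surjective`, then `placeEmb_galAdicCompletionMap`).
[cite: CasselsFrohlichANT1967, Ch. VII §1.1] -/
theorem localHomUnit_ρ {h : X.V →+ UnitsCarrier (v.adicCompletion K)} (hh : IsLocalHom v ιE X h)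
    (g : MulAction.stabilizer (E ≃ₐ[K] E) (embPlace v ιE)) (x : X.V) :
    (localHomUnit hh (X.ρ (g : E ≃ₐ[K] E) x) : (embPlace v ιE : HeightOneSpectrum (𝓞 E)).adicCompletion E) =
      galAdicCompletionMap (g : E ≃ₐ[K] E) (coe_stabilizer_smul (embPlace v ιE) g)
        (localHomUnit hh x : (embPlace v ιE : HeightOneSpectrum (𝓞 E)).adicCompletion E) := by
  obtain ⟨d, rfl⟩ := galRestrictStab_surjective v ιE g
  apply placeEmb_injective v ιE
  change placeEmb v ιE (localHomVal hh (X.ρ (galRestrict v ιE d) x)) =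
    placeEmb v ιE (galAdicCompletionMap (galRestrict v ιE d)
      (coe_stabilizer_smul (embPlace v ιE) (galRestrictStab v ιE d)) (localHomVal hh x))
  rw [placeEmb_galAdicCompletionMap v ιE (ιE_galRestrict v ιE d), placeEmb_localHomVal, placeEmb_localHomVal, hh d x,
    unitsVal_apply, Units.coe_smul]

/-- `θ ∘ h` as an additive map `X → Additive E_{w_v}ˣ` (auxiliary). [cite: CasselsFrohlichANT1967, Ch. VII §1.1] -/
def localHomLiftAddHom {h : X.V →+ UnitsCarrier (v.adicCompletion K)} (hh : IsLocalHom v ιE X h) :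
    X.V →+ Additive ((embPlace v ιE : HeightOneSpectrum (𝓞 E)).adicCompletion E)ˣ where
  toFun x := Additive.ofMul (localHomUnit hh x)
  map_zero' := by rw [localHomUnit_zero]; rfl
  map_add' x y := by rw [localHomUnit_add]; rfl

/-- **The `G_{w_v}`-morphism `θ ∘ h : Res_{G_{w_v}} X ⟶ E_{w_v}ˣ` attached to a local equivariant `h : X → K̄_vˣ`.**
[cite: MilneADT2006, I Lemma 4.13 (proof)] [cite: CasselsFrohlichANT1967, Ch. VII §1.1] -/
def localHomLift {h : X.V →+ UnitsCarrier (v.adicCompletion K)} (hh : IsLocalHom v ιE X h) :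
    Rep.res (MulAction.stabilizer (E ≃ₐ[K] E) (embPlace v ιE)).subtype X ⟶ localUnitsRep (embPlace v ιE) :=
  letI : Module ℤ X.V := X.hV2
  Rep.ofHom (ρ := (Rep.res (MulAction.stabilizer (E ≃ₐ[K] E) (embPlace v ιE)).subtype X).ρ)
    ⟨{ toFun := localHomLiftAddHom hh
       map_add' := fun x y => map_add (localHomLiftAddHom hh) x y
       map_smul' := fun c x => map_intCast_smul (localHomLiftAddHom hh) ℤ ℤ c x },
      fun g => LinearMap.ext fun x => Additive.toMul.injective (Units.ext (by
        change (localHomUnit hh (X.ρ (g : E ≃ₐ[K] E) x) : (embPlace v ιE : HeightOneSpectrum (𝓞 E)).adicCompletion E) =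
          ((Additive.toMul ((localUnitsRep (embPlace v ιE)).ρ g (Additive.ofMul (localHomUnit hh x))) :
            ((embPlace v ιE : HeightOneSpectrum (𝓞 E)).adicCompletion E)ˣ) :
              (embPlace v ιE : HeightOneSpectrum (𝓞 E)).adicCompletion E)
        rw [localHomUnit_ρ, val_toMul_localUnitsRep_ρ]
        rfl))⟩

/-- Unfolding `localHomLift`: its value at `x` is the unit `θ(h x)`. [cite: CasselsFrohlichANT1967, Ch. VII §1.1] -/
theorem toMul_localHomLift {h : X.V →+ UnitsCarrier (v.adicCompletion K)} (hh : IsLocalHom v ιE X h) (x : X.V) :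
    Additive.toMul (α := ((embPlace v ιE : HeightOneSpectrum (𝓞 E)).adicCompletion E)ˣ) ((localHomLift hh).hom x) =
      localHomUnit hh x := rfl

/-- **`placeEmb (θ h x) = h x`**: the lift read back in `K̄_v` is `h`. [cite: MilneADT2006, I Lemma 4.13 (proof)] -/
theorem placeEmb_localHomLift {h : X.V →+ UnitsCarrier (v.adicCompletion K)} (hh : IsLocalHom v ιE X h) (x : X.V) :
    placeEmb v ιE ((Additive.toMul (α := ((embPlace v ιE : HeightOneSpectrum (𝓞 E)).adicCompletion E)ˣ)
      ((localHomLift hh).hom x) : ((embPlace v ιE : HeightOneSpectrum (𝓞 E)).adicCompletion E)ˣ) :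
        (embPlace v ιE : HeightOneSpectrum (𝓞 E)).adicCompletion E) =
      (unitsVal (v.adicCompletion K) (h x) : AlgebraicClosure (v.adicCompletion K)) :=
  placeEmb_localHomVal hh x

/-- **Units: `θ(h x) ∈ 𝒪_{w_v}ˣ ↔ ‖h x‖ = 1`** (`mem_placeUnitGroup_iff_algNorm_placeEmb`).
[cite: SerreLocalFields1979, Ch. II §2 Cor. 4] [cite: MilneADT2006, I Lemma 4.13 (proof)] -/
theorem mem_placeUnitGroup_localHomLift_iff {h : X.V →+ UnitsCarrier (v.adicCompletion K)}
    (hh : IsLocalHom v ιE X h) (x : X.V) :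
    Additive.toMul (α := ((embPlace v ιE : HeightOneSpectrum (𝓞 E)).adicCompletion E)ˣ) ((localHomLift hh).hom x) ∈
        placeUnitGroup (embPlace v ιE) ↔
      IsNonarchimedeanLocalField.algNorm (v.adicCompletion K)
        (unitsVal (v.adicCompletion K) (h x) : AlgebraicClosure (v.adicCompletion K)) = 1 := by
  rw [mem_placeUnitGroup_iff_algNorm_placeEmb, toMul_localHomLift]
  change IsNonarchimedeanLocalField.algNorm _ (placeEmb v ιE (localHomVal hh x)) = 1 ↔ _
  rw [placeEmb_localHomVal]

/-- **The `G`-morphism `X ⟶ ∏_{w∣v} E_wˣ` assembled from a local equivariant `h : X → K̄_vˣ`**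
(`assemble w_v (θ ∘ h)`). [cite: MilneADT2006, I Lemma 4.13 (proof)] [cite: Harari2020, §13.1] -/
def assembleLocalHom {h : X.V →+ UnitsCarrier (v.adicCompletion K)} (hh : IsLocalHom v ιE X h) : X ⟶ unitsRep K E v :=
  assemble (embPlace v ιE) (localHomLift hh)

/-- The distinguished component of `assembleLocalHom hh x` is `θ(h x)`. [cite: MilneADT2006, I Lemma 4.13 (proof)] -/
theorem unitsProj_assembleLocalHom {h : X.V →+ UnitsCarrier (v.adicCompletion K)} (hh : IsLocalHom v ιE X h)
    (x : X.V) : unitsProj (embPlace v ιE) ((assembleLocalHom hh).hom x) = (localHomLift hh).hom x :=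
  unitsProj_assemble _ _ x

/-- **If `‖h x‖ = 1` for all `x`, the assembled map takes values in `∏_{w∣v} 𝒪_wˣ`.**
[cite: MilneADT2006, I Lemma 4.13 (proof)] [cite: Harari2020, §13.1] -/
theorem toMul_assembleLocalHom_mem_unitGroup {h : X.V →+ UnitsCarrier (v.adicCompletion K)}
    (hh : IsLocalHom v ιE X h)
    (hunit : ∀ x : X.V, IsNonarchimedeanLocalField.algNorm (v.adicCompletion K)
      (unitsVal (v.adicCompletion K) (h x) : AlgebraicClosure (v.adicCompletion K)) = 1) (x : X.V) :
    Additive.toMul (α := (SemiLocal K E v)ˣ) ((assembleLocalHom hh).hom x) ∈ unitGroup K E v :=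
  toMul_assemble_mem_unitGroup _ _ (fun y => (mem_placeUnitGroup_localHomLift_iff hh y).mpr (hunit y)) x

/-- **The `G`-morphism `X ⟶ ∏_{w∣v} 𝒪_wˣ` assembled from a unit-valued local equivariant `h`.**
[cite: MilneADT2006, I Lemma 4.13 (proof)] [cite: Harari2020, §13.1] -/
def assembleLocalHomUnit {h : X.V →+ UnitsCarrier (v.adicCompletion K)} (hh : IsLocalHom v ιE X h)
    (hunit : ∀ x : X.V, IsNonarchimedeanLocalField.algNorm (v.adicCompletion K)
      (unitsVal (v.adicCompletion K) (h x) : AlgebraicClosure (v.adicCompletion K)) = 1) :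
    X ⟶ unitGroupRep K E v :=
  assembleUnit (embPlace v ιE) (localHomLift hh) fun y => (mem_placeUnitGroup_localHomLift_iff hh y).mpr (hunit y)

/-- `assembleLocalHomUnit ≫ (∏ 𝒪_wˣ ↪ ∏ E_wˣ) = assembleLocalHom`. [cite: Harari2020, §13.1] -/
theorem assembleLocalHomUnit_comp {h : X.V →+ UnitsCarrier (v.adicCompletion K)} (hh : IsLocalHom v ιE X h)
    (hunit : ∀ x : X.V, IsNonarchimedeanLocalField.algNorm (v.adicCompletion K)
      (unitsVal (v.adicCompletion K) (h x) : AlgebraicClosure (v.adicCompletion K)) = 1) :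
    assembleLocalHomUnit hh hunit ≫ unitGroupRepHom K E v = assembleLocalHom hh :=
  assembleUnit_comp_unitGroupRepHom _ _ _

/-! ## §3. Conversely: the readout `placeEmb ∘ pr_{w_v} ∘ Φ` of a `G`-morphism `Φ : X ⟶ ∏_{w∣v} E_wˣ` -/

variable (v ιE)

omit [IsGalois K E] in
/-- The component of `g • u` at a place `w` fixed by `g`: `pr_w(g • u) = g_w(pr_w u)`.
[cite: CasselsFrohlichANT1967, Ch. VII §1.1] -/
theorem unitsProj_ρ_stabilizer (w : Place K E v) (g : MulAction.stabilizer (E ≃ₐ[K] E) w)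
    (u : Additive (SemiLocal K E v)ˣ) :
    unitsProj w ((unitsRep K E v).ρ (g : E ≃ₐ[K] E) u) = (localUnitsRep w).ρ g (unitsProj w u) := by
  rw [← costabilizerRep_apply, CoinducedModule.costabilizerRep_proj]
  rfl

/-- **The local readout `X → K̄_vˣ` of a `G`-morphism `Φ : X ⟶ ∏_{w∣v} E_wˣ`**: the `w_v`-component followed by
`placeEmb : E_{w_v} → K̄_v`. [cite: MilneADT2006, I Lemma 4.13 (proof)] [cite: Harari2020, §13.1] -/
def localReadout (Φ : X ⟶ unitsRep K E v) : X.V →+ UnitsCarrier (v.adicCompletion K) :=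
  letI : Module ℤ X.V := X.hV2
  (MonoidHom.toAdditive (Units.map (placeEmb v ιE).toRingHom.toMonoidHom)).comp
    ((unitsProj (embPlace v ιE)).toAddMonoidHom.comp Φ.hom.toLinearMap.toAddMonoidHom)

/-- Unfolding `localReadout`: `unitsVal (localReadout Φ x) = placeEmb ((Φ x)_{w_v})`.
[cite: MilneADT2006, I Lemma 4.13 (proof)] -/
theorem unitsVal_localReadout (Φ : X ⟶ unitsRep K E v) (x : X.V) :
    unitsVal (v.adicCompletion K) (localReadout v ιE Φ x) =
      Units.map (placeEmb v ιE).toRingHom.toMonoidHom (Additive.toMul (unitsProj (embPlace v ιE) (Φ.hom x))) := rfl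

/-- Same, on underlying elements of `K̄_v`. [cite: MilneADT2006, I Lemma 4.13 (proof)] -/
theorem coe_unitsVal_localReadout (Φ : X ⟶ unitsRep K E v) (x : X.V) :
    (unitsVal (v.adicCompletion K) (localReadout v ιE Φ x) : AlgebraicClosure (v.adicCompletion K)) =
      placeEmb v ιE ((Additive.toMul (unitsProj (embPlace v ιE) (Φ.hom x)) :
        ((embPlace v ιE : HeightOneSpectrum (𝓞 E)).adicCompletion E)ˣ) :
          (embPlace v ιE : HeightOneSpectrum (𝓞 E)).adicCompletion E) := rfl

/-- **The readout of a `G`-morphism is `Γ_{K_v}`-equivariant.** [cite: MilneADT2006, I Lemma 4.13 (proof)]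
[cite: CasselsFrohlichANT1967, Ch. VII §1.1] -/
theorem isLocalHom_localReadout (Φ : X ⟶ unitsRep K E v) : IsLocalHom v ιE X (localReadout v ιE Φ) := by
  intro d x
  apply unitsVal_injective
  apply Units.ext
  rw [unitsVal_apply, Units.coe_smul, coe_unitsVal_localReadout, coe_unitsVal_localReadout, Rep.hom_comm_apply]
  have h1 := unitsProj_ρ_stabilizer v (embPlace v ιE) (galRestrictStab v ιE d)
    (show Additive (SemiLocal K E v)ˣ from Φ.hom x)
  rw [coe_galRestrictStab] at h1
  rw [h1, val_toMul_localUnitsRep_ρ]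
  exact placeEmb_galAdicCompletionMap v ιE (ιE_galRestrict v ιE d) _ _

variable {v ιE}

/-- **`localReadout (assembleLocalHom h) = h`.** [cite: MilneADT2006, I Lemma 4.13 (proof)] -/
theorem localReadout_assembleLocalHom {h : X.V →+ UnitsCarrier (v.adicCompletion K)} (hh : IsLocalHom v ιE X h) :
    localReadout v ιE (assembleLocalHom hh) = h := by
  refine AddMonoidHom.ext fun x => unitsVal_injective _ (Units.ext ?_)
  rw [coe_unitsVal_localReadout, unitsProj_assembleLocalHom]
  exact placeEmb_localHomLift hh x

/-- **`assembleLocalHom (localReadout Φ) = Φ`**: `Φ ↦ localReadout Φ` and `h ↦ assembleLocalHom h` are inverse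
bijections `Hom_G(X, ∏_{w∣v} E_wˣ) ≃ {Γ_{K_v}-equivariant X → K̄_vˣ}`. [cite: MilneADT2006, I Lemma 4.13 (proof)] -/
theorem assembleLocalHom_localReadout (Φ : X ⟶ unitsRep K E v) :
    assembleLocalHom (isLocalHom_localReadout v ιE Φ) = Φ := by
  refine (eq_assemble_of_unitsProj_eq (embPlace v ιE) _ fun x => ?_).symm
  apply Additive.toMul.injective
  rw [toMul_localHomLift, eq_comm, localHomUnit_eq_iff]
  exact (coe_unitsVal_localReadout v ιE Φ x).symm

/-- Two `G`-morphisms `X ⟶ ∏_{w∣v} E_wˣ` with the same local readout are equal. [cite: MilneADT2006, I Lemma 4.13 (proof)] -/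
theorem hom_ext_of_localReadout_eq {Φ Ψ : X ⟶ unitsRep K E v}
    (h : localReadout v ιE Φ = localReadout v ιE Ψ) : Φ = Ψ := by
  rw [← assembleLocalHom_localReadout (ιE := ιE) Φ, ← assembleLocalHom_localReadout (ιE := ιE) Ψ]
  congr 1

end IdeleReadout

end Literature.NumberTheory.GaloisRepresentations

end
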